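import Summits.HubbardSuperconductivity.HubbardSuperconductivity.Theses.ComplexGFFStiffness

/-!
# BC3 birth skeleton — crux `HypACumulant` of route `route-HubbardSuperconductivity-ComplexGFFStiffness`

Plan-only line `birth` (crux item stmt-HubbardSuperconductivity-19154, rank 2): the crux splits into
(i) N-uniform NON-VANISHING of the complex partition function along the tower (`ZNonvanishing`; the
representation half of the renormalisation group, [ABKM19] = arXiv:1910.13564 Ch. 4, p.28 of the held
text: 𝒵(Ĥ₀(K₀,q),K₀,q) = ∫(1 + K_N) dμ^{(q)}_{N+1} with ‖K_N‖ ≤ Cη^N exponentially small — read on the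
ι-symmetric class E^ι, |∫(1+K_N)dμ − 1| ≤ ‖K_N‖ < 1 gives Z ≠ 0 for every N; this is the route
header's PLAN-ONLY first rung `stub_zNonvanishing : ZNonvanishing`, shared with the sibling crux
`HypALocalTwoPoint`) and (ii) the derivative bound GIVEN non-vanishing (`CumulantGivenZ`; the
smoothness half, [ABKM19] Secs. 10–12, ℓ = 2, along the real tilt ε ↦ (1+𝒦_g)e^{εQ_u} − 1).

Registrar shape (as `Summits/ABC/ABC/Cruxes/BalancedFamily/Lines/birth.lean`): the composition
`HypACumulant_of_stubs : ZNonvanishing → CumulantGivenZ → <body of HypACumulant>` is a REAL proof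
(merge L₀ by `max`, g₀ by `min`; no `sorry` in its closure), and the registered target
`HypACumulant_of : HypACumulant := HypACumulant_of_stubs stub_zNonvanishing stub_cumulantGivenZ`
concludes the crux BY NAME with no hypotheses; `sorry` occurs ONLY in the two `stub_*` theorems, so
`#print axioms HypACumulant_of` reaches `sorryAx` exactly through them. (The stub statements are plain
`def`s, not `@[stub]`-tagged: crux workfiles may not carry gate-reserved attributes, and the by-name
target needs none.) Stub probes (inline, farm rc 0, 2026-08-25, planner-xylro-ideate-p3 lineage): no
stub cheaply gives the crux or the summit (`#h21_crux_probe … summit := HypACumulant` /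
`summit := HubbardSuperconductivity` → CLEAN). The typed RG interface (finite-range decomposition,
norms, the map 𝒯, fine tuning) that the stubs' proofs need is the first definition request of the
seat that claims this crux (route header §Not decomposed yet).
-/

-- `Summit.<Summit>.<Problem>`: for the single-conjunct summit the duplicate `HubbardSuperconductivity.HubbardSuperconductivity` is mandated.
set_option linter.dupNamespace false

namespace Summit.HubbardSuperconductivity.HubbardSuperconductivity.Cruxes.HypACumulant.Birth

open Literature.MathematicalPhysics.StatisticalMechanics.ComplexGradientGFF4 (Z ev Y D CumulantBoundAt)
open Summit.HubbardSuperconductivity.HubbardSuperconductivity.Theses.ComplexGFFStiffness (HypACumulant)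

/-! ## Stub statements -/

/-- N-uniform non-vanishing of the complex partition function `Z_{L^N}(g,0)` along the tower, for all
large odd `L` and `0 ≤ g ≤ g₀(L)` (shared first stub of both cruxes of the route; the header's
plan-only BC5 rung). -/
def ZNonvanishing : Prop :=
  ∃ L₀ : ℕ, ∀ L : ℕ, Odd L → L₀ ≤ L → ∃ g₀ : ℝ, 0 < g₀ ∧
    ∀ g : ℝ, 0 ≤ g → g ≤ g₀ → ∀ N : ℕ, 1 ≤ N → ∀ (n : ℕ) [NeZero n], n = L ^ N → Z n g 0 ≠ 0

/-- The N-uniform second-cumulant bound for the tilt response `Y_u`, GIVEN non-vanishing of `Z`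
(= [ABKM19] Thm 2.2, ℓ = 2, transcribed to the ι-symmetric complex class, with `Z ≠ 0` moved into
the hypotheses). -/
def CumulantGivenZ : Prop :=
  ∃ L₀ : ℕ, ∀ L : ℕ, Odd L → L₀ ≤ L → ∃ g₀ C : ℝ, 0 < g₀ ∧
    ∀ g : ℝ, 0 ≤ g → g ≤ g₀ → ∀ N : ℕ, 1 ≤ N → ∀ (n : ℕ) [NeZero n], n = L ^ N → Z n g 0 ≠ 0 →
      ∀ u : Fin 4 → ℝ,
        ‖ev n g (fun φ => ((Y u φ ^ 2 : ℝ) : ℂ)) - (ev n g (fun φ => ((Y u φ : ℝ) : ℂ))) ^ 2‖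
          ≤ C * (Fintype.card (Fin 4 → ZMod n) : ℝ) * ∑ i : Fin 4, (u i) ^ 2

/-! ## The registered stubs (the ONLY `sorry`s of the file) -/

/-- **Stub 1 — `stub_zNonvanishing` (OPEN; the route header's plan-only first rung; size L).**
Why plausibly true: [ABKM19] Ch. 4 representation `Z = ∫(1+K_N)dμ` with ‖K_N‖ ≤ Cη^N on the real
class; the bet is that every RG step preserves ι-symmetry so the same representation holds on the
complex ι-symmetric class. Why it might fail: a zero of `Z_{L^N}(g,0)` at fixed small `g` for some
large `N` (Lee–Yang-type accumulation) — exactly the route's kill criterion. -/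
theorem stub_zNonvanishing : ZNonvanishing := by
  sorry

/-- **Stub 2 — `stub_cumulantGivenZ` (OPEN; the smoothness half; size L).** [ABKM19] Secs. 10–12:
C² dependence of the renormalised free energy on the tilt, uniformly in N, given the flow exists
(which is what `Z ≠ 0` along the tower records here). Why it might fail: the fine-tuned quadratic
form must stay real on the ι-symmetric class (route header, crux docstring: three loci). -/
theorem stub_cumulantGivenZ : CumulantGivenZ := by
  sorry

/-! ## Composition (sorry-free) and the registered target -/

/-- **Composition (kernel-checked, no `sorry` in its closure).** The two stub statements imply the
crux statement — verbatim the body of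
`Summit.HubbardSuperconductivity.HubbardSuperconductivity.Theses.ComplexGFFStiffness.HypACumulant` —
by merging the thresholds (`L₀ := max`, `g₀ := min`) and feeding the non-vanishing into the
conditional bound. [folklore] -/
theorem HypACumulant_of_stubs (h₁ : ZNonvanishing) (h₂ : CumulantGivenZ) :
    ∃ L₀ : ℕ, ∀ L : ℕ, Odd L → L₀ ≤ L → ∃ g₀ C : ℝ, 0 < g₀ ∧ CumulantBoundAt L g₀ C := by
  obtain ⟨L₁, h₁⟩ := h₁
  obtain ⟨L₂, h₂⟩ := h₂
  refine ⟨max L₁ L₂, fun L hL hle => ?_⟩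
  obtain ⟨g₁, hg₁, hZ⟩ := h₁ L hL (le_trans (le_max_left _ _) hle)
  obtain ⟨g₂, C, hg₂, hC⟩ := h₂ L hL (le_trans (le_max_right _ _) hle)
  refine ⟨min g₁ g₂, C, lt_min hg₁ hg₂, ?_⟩
  intro g hg0 hg N hN n _ hn
  have hz : Z n g 0 ≠ 0 := hZ g hg0 (le_trans hg (min_le_left _ _)) N hN n hn
  exact ⟨hz, hC g hg0 (le_trans hg (min_le_right _ _)) N hN n hn hz⟩

/-- **Registered target of the skeleton (BC3).** The crux BY NAME, no hypotheses:
`HypACumulant_of_stubs` applied to the two declared stubs; `#print axioms` reaches `sorryAx` exactly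
through `stub_zNonvanishing` and `stub_cumulantGivenZ`. This is the theorem `#h21_check_skeleton`
keys on (the only theorem of the file whose conclusion is the crux decl). -/
theorem HypACumulant_of : HypACumulant :=
  HypACumulant_of_stubs stub_zNonvanishing stub_cumulantGivenZ

end Summit.HubbardSuperconductivity.HubbardSuperconductivity.Cruxes.HypACumulant.Birth
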